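import Literature.Geometry.Riemannian.CurvatureAsDivergence
import HarnessLib

/-!
# The Bochner formula for vector fields, integrated (Yano's formula):
# `∫ Ric(Y, Y) + ∫ tr(∇Y ∘ ∇Y) = ∫ (div Y)²` on a closed Riemannian manifold

For a smooth pseudo-Riemannian metric `g` with its Levi-Civita connection `∇`
(`LeviCivita.lean`), a smooth vector field `Y`, the covariant differential `∇Y : v ↦ ∇_v Y`, the
divergence `div Y = tr ∇Y` (`PseudoRiemannianMetric.vectorDivergence`, `DivergenceTheorem.lean`)
and the Ricci tensor `Ric` (`PseudoRiemannianMetric.ricci`), we PROVE: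

* `vectorDivergence_bochnerField` — **the Bochner formula for vector fields, in divergence form**
  (pointwise, any signature):
  `div(∇_Y Y − (div Y) Y) = Ric(Y, Y) + tr(∇Y ∘ ∇Y) − (div Y)²`,
  the trace of the Ricci identity `∇²_{V,W} Y − ∇²_{W,V} Y = R(V, W) Y` (O'Neill 1983, Ch. 3,
  Prop. 3.37 ff.; Gallot–Hulin–Lafontaine 2004, Prop. 4.36 `Δα = D*Dα + Ric(α)` for the dual
  `1`-form). It is TRANSPORTED from the coordinate identity
  `MetricCoord.IsMetricOn.divAt_covDAt_self_sub` (`CoordDivergenceIdentity.lean`,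
  `div(∇_Z Z) − ∂_Z(div Z) = Ric(Z,Z) + tr((∇Z)²)`) exactly as the surface identity
  `vectorDivergence_normalizedAcceleration` of `CurvatureAsDivergence.lean`: everything is read in
  the chart at the point through the local isometry `Φ = chartInv I x` (`vectorRep`, `metricRep`,
  `vectorDivergence_eq_divAt_metricRep`, `vectorRep_leviCivita_self`, and here
  `ricci_eq_ricAt_metricRep`, `trace_leviCivita_comp_self_eq`);
* `contMDiffAt_bochnerField`, `contMDiff_trace_leviCivita_comp_self`,
  `contMDiff_vectorDivergence` — smoothness of the field `∇_Y Y − (div Y) Y` and of the functions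
  `tr(∇Y ∘ ∇Y)`, `div Y` for smooth `Y` (chart criterion, `contMDiffAt_of_chartInv_eq`); the
  smoothness of `Ric(Y, Y)` is `PseudoRiemannianMetric.contMDiff_ricci_apply'`
  (`Lorentzian/CurvatureRegularity.lean`);
* `integral_ricci_add_trace_sub_divergence_sq_eq_zero` and
  `integral_ricci_add_integral_trace_eq_integral_divergence_sq` — **Yano's integral formula** on a
  closed Riemannian manifold `(N, h)` modelled on `ℝᵐ`:
  `∫_N (Ric(Y,Y) + tr(∇Y ∘ ∇Y) − (div Y)²) dμ_h = 0`, i.e.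
  `∫ Ric(Y,Y) dμ_h + ∫ tr(∇Y ∘ ∇Y) dμ_h = ∫ (div Y)² dμ_h` (K. Yano, *On harmonic and Killing
  vector fields*, Ann. of Math. 55 (1952) 38–45, formula (1.8); Gallot–Hulin–Lafontaine 2004,
  proof of Thm. 4.37: "`⟨Δα, α⟩ = ⟨Dα, Dα⟩ + ∫_M Ric(α, α) v_g`", which is the same identity since
  `⟨Δα, α⟩ = ‖dα‖² + ‖δα‖²` and `|∇α|² − tr(∇Y ∘ ∇Y) = ½|dα|²` for `α = Y♭`), by the divergence
  theorem `integral_vectorDivergence_eq_zero`.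

This is the integrated Bochner formula behind Bochner's vanishing theorem (GHL Thm. 4.37),
Lichnerowicz-type lower bounds for the Hodge Laplacian on `1`-forms — e.g. Aubry 2005, Lemme 9
(`λ₁¹(M) ≥ n` under `Ric ≥ n − 1`), the input of Prop. 10 (ii) of the eigenvalue pinching theorem
`aubry_diffeomorph_sphere_of_eigenvalue_pinching` for which this file was written — and Reilly's
formula. Everything is proved; no definition and no statement of `Prop` type is introduced (the
"Bochner field" `∇_Y Y − (div Y) Y` is written out).

## References

* S. Gallot, D. Hulin, J. Lafontaine, *Riemannian Geometry*, 3rd ed., Springer 2004, Prop. 4.15,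
  Prop. 4.36, Thm. 4.37 (proof). [GallotHulinLafontaine2004]
* B. O'Neill, *Semi-Riemannian geometry with applications to relativity*, Academic Press 1983,
  Ch. 3, Prop. 3.13, Prop. 3.37, Lemma 3.52, Prop. 3.59, p. 86. [ONeill1983]
* K. Yano, *On harmonic and Killing vector fields*, Ann. of Math. (2) 55 (1952) 38–45, (1.8).
* E. Aubry, *Pincement sur le spectre et le volume en courbure de Ricci positive*, Ann. Sci. École
  Norm. Sup. (4) 38 (2005) 387–405, Lemme 9 (p. 392). [Aubry2005]
-/

noncomputable section

set_option maxSynthPendingDepth 3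

open Bundle Set Function Filter FiberBundle VectorField ContinuousLinearMap TopologicalSpace MeasureTheory
open scoped Manifold ContDiff Topology

namespace Literature.Geometry.Riemannian

open Lorentzian Lorentzian.OpensChart Lorentzian.PseudoRiemannianMetric Lorentzian.MetricCoord

/-! ### The coordinate identity in divergence form -/

section Coord

variable {E : Type*} [NormedAddCommGroup E] [NormedSpace ℝ E] [FiniteDimensional ℝ E]
  [CompleteSpace E] {G : E → E →L[ℝ] E →L[ℝ] ℝ} {V : Set E} {x : E} {Z : E → E}

omit [CompleteSpace E] in
/-- `div(W − U) = div W − div U` for fields differentiable at the point. [folklore] -/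
theorem _root_.Literature.Geometry.Lorentzian.MetricCoord.divAt_sub {W U : E → E}
    (hW : DifferentiableAt ℝ W x) (hU : DifferentiableAt ℝ U x) :
    divAt G (fun y ↦ W y - U y) x = divAt G W x - divAt G U x := by
  rw [divAt_eq, divAt_eq, divAt_eq, covDAt_sub hW hU, map_sub]

/-- **The Bochner formula for a vector field in coordinates, divergence form**: for a smooth
vector field `Z` on `V`,
`div(∇_Z Z − (div Z) Z)(x) = Ric(Z, Z)(x) + tr((∇Z|_x)²) − (div Z (x))²`
(`divAt_covDAt_self_sub` together with the Leibniz rule `div((div Z) Z) = (div Z)² + ∂_Z div Z`).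
[cite: ONeill1983, Ch. 3, Prop. 3.37] [cite: GallotHulinLafontaine2004, Prop. 4.36] -/
theorem _root_.Literature.Geometry.Lorentzian.MetricCoord.IsMetricOn.divAt_bochnerField
    (hG : IsMetricOn G V) (hx : x ∈ V) (hZ : ContDiffOn ℝ ∞ Z V) :
    divAt G (fun y ↦ covDAt G Z y (Z y) - divAt G Z y • Z y) x =
      ricAt G x (Z x) (Z x) + traceCLM E ((covDAt G Z x).comp (covDAt G Z x)) -
        divAt G Z x ^ 2 := by
  have hZx : ContDiffAt ℝ ∞ Z x := (hZ x hx).contDiffAt (hG.mem_nhds hx)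
  have hZd : DifferentiableAt ℝ Z x := hZx.differentiableAt (by simp)
  have h1 : DifferentiableAt ℝ (fun y ↦ covDAt G Z y (Z y)) x :=
    (hG.hasFDerivAt_covDAt_self hx hZ).differentiableAt
  have hdiv : DifferentiableAt ℝ (divAt G Z) x := (hG.hasFDerivAt_divAt hx hZ).differentiableAt
  have h2 : DifferentiableAt ℝ (fun y ↦ divAt G Z y • Z y) x := hdiv.smul hZd
  have key := hG.divAt_covDAt_self_sub hx hZ
  rw [divAt_sub h1 h2, divAt_smul hdiv hZd]
  linear_combination key

end Coord

/-! ### Reading `Ric(Y, Y)`, `tr(∇Y ∘ ∇Y)` and the Bochner field in a chart -/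

section Chart

variable {E : Type*} [NormedAddCommGroup E] [NormedSpace ℝ E] {H : Type*} [TopologicalSpace H]
  {I : ModelWithCorners ℝ E H} [I.Boundaryless] {M : Type*} [TopologicalSpace M]
  [ChartedSpace H M] [IsManifold I ∞ M] [FiniteDimensional ℝ E] [CompleteSpace E]
  (g : PseudoRiemannianMetric I ∞ E (TangentSpace I : M → Type _)) [g.HasLeviCivita]

omit [CompleteSpace E] [g.HasLeviCivita] in
/-- `dΦ_u ((Φ^* Y) u) = Y (Φ u)`: a pulled-back field read back through `dΦ`. [folklore] -/
theorem mfderiv_chartInv_mpullback (x₁ : M) (Y : Π x : M, TangentSpace I x) (u : chartTarget I x₁) :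
    mfderiv 𝓘(ℝ, E) I (chartInv I x₁) u (mpullback 𝓘(ℝ, E) I (chartInv I x₁) Y u) =
      Y (chartInv I x₁ u) := by
  rw [mpullback_apply, ← ContinuousLinearMap.comp_apply,
    (isInvertible_mfderiv_of_injective rfl (injective_mfderiv_chartInv x₁ u)).self_comp_inverse]
  rfl

/-- **The Ricci tensor in the chart**: `Ric_g(Y, Z)(Φ u) = ricAt Ĝ u (Ŷ u) (Ẑ u)` (naturality of
the Ricci tensor under the local isometry `Φ`, `ricci_comap_apply`, and `ricci_eq_ricAt` on the
chart target). [cite: ONeill1983, Ch. 3, Prop. 3.59 and Lemma 3.52] -/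
theorem ricci_eq_ricAt_metricRep (x₁ : M) (Y Z : Π x : M, TangentSpace I x) (u : chartTarget I x₁) :
    g.ricci (chartInv I x₁ u) (Y (chartInv I x₁ u)) (Z (chartInv I x₁ u)) =
      ricAt (metricRep I g x₁) u (vectorRep I x₁ Y u) (vectorRep I x₁ Z u) := by
  haveI := (chartPullback I g x₁).hasLeviCivita
  rw [← mpullback_chartInv_apply, ← mpullback_chartInv_apply,
    ← OpensChart.ricci_eq_ricAt (val_chartPullback_eq_metricRep g x₁) u,
    g.ricci_comap_apply contMDiff_pullbackBilin_holds (contMDiff_chartInv x₁)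
      (injective_mfderiv_chartInv x₁) rfl u, mfderiv_chartInv_mpullback, mfderiv_chartInv_mpullback]

/-- **`tr(∇Y ∘ ∇Y)` in the chart**: `tr(∇Y|_{Φ u} ∘ ∇Y|_{Φ u}) = tr(covDAt Ĝ Ŷ u ∘ covDAt Ĝ Ŷ u)`
(the covariant differentials of `Y` and of `Φ^* Y` are conjugate by `dΦ_u`,
`leviCivita_comap_mpullback_apply`; then `leviCivita_eq_covDAt` on the chart target).
[cite: ONeill1983, Ch. 3, Prop. 3.59 and Prop. 3.13] -/
theorem trace_leviCivita_comp_self_eq (x₁ : M) {Y : Π x : M, TangentSpace I x}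
    (u : chartTarget I x₁) (hY : MDiffAt (T% Y) (chartInv I x₁ u))
    (hYf : DifferentiableAt ℝ (vectorRep I x₁ Y) u) :
    LinearMap.trace ℝ (TangentSpace I (chartInv I x₁ u))
        ((g.leviCivita Y (chartInv I x₁ u)).toLinearMap ∘ₗ
          (g.leviCivita Y (chartInv I x₁ u)).toLinearMap) =
      traceCLM E ((covDAt (metricRep I g x₁) (vectorRep I x₁ Y) u).comp
        (covDAt (metricRep I g x₁) (vectorRep I x₁ Y) u)) := by
  haveI := (chartPullback I g x₁).hasLeviCivita
  haveI : FiniteDimensional ℝ (TangentSpace I (chartInv I x₁ u)) :=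
    inferInstanceAs (FiniteDimensional ℝ E)
  haveI : Module.Finite ℝ (TangentSpace 𝓘(ℝ, E) u) := inferInstanceAs (Module.Finite ℝ E)
  haveI : Module.Free ℝ (TangentSpace 𝓘(ℝ, E) u) := inferInstanceAs (Module.Free ℝ E)
  haveI : Module.Free ℝ (TangentSpace I (chartInv I x₁ u)) := inferInstanceAs (Module.Free ℝ E)
  have hcov := leviCivita_eq_covDAt (val_chartPullback_eq_metricRep g x₁) u
    (W := mpullback 𝓘(ℝ, E) I (chartInv I x₁) Y) (fun y ↦ mpullback_chartInv_apply x₁ Y y) hYf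
  -- the two covariant differentials are conjugate by `dΦ_u`
  set e := mfderivEquivOfInjective (I := I) (I' := 𝓘(ℝ, E)) (chartInv I x₁) u
    (injective_mfderiv_chartInv x₁ u) rfl with hedef
  have hconj : ((chartPullback I g x₁).leviCivita (mpullback 𝓘(ℝ, E) I (chartInv I x₁) Y) u :
      TangentSpace 𝓘(ℝ, E) u →ₗ[ℝ] TangentSpace 𝓘(ℝ, E) u) = e.symm.toLinearMap ∘ₗ
        (g.leviCivita Y (chartInv I x₁ u) : TangentSpace I (chartInv I x₁ u) →ₗ[ℝ]
          TangentSpace I (chartInv I x₁ u)) ∘ₗ e.toLinearMap := by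
    refine LinearMap.ext fun v ↦ ?_
    simp only [LinearMap.coe_comp, Function.comp_apply, ContinuousLinearMap.coe_coe,
      LinearEquiv.coe_coe]
    rw [g.leviCivita_comap_mpullback_apply contMDiff_pullbackBilin_holds (contMDiff_chartInv x₁)
      (injective_mfderiv_chartInv x₁) rfl hY v]
    apply e.injective
    rw [LinearEquiv.apply_symm_apply, hedef, mfderivEquivOfInjective_apply,
      ← ContinuousLinearMap.comp_apply,
      (isInvertible_mfderiv_of_injective rfl (injective_mfderiv_chartInv x₁ u)).self_comp_inverse]
    rfl
  -- the coordinate side is the trace of the square of the pulled-back covariant differential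
  have hR : traceCLM E ((covDAt (metricRep I g x₁) (vectorRep I x₁ Y) u).comp
      (covDAt (metricRep I g x₁) (vectorRep I x₁ Y) u)) =
      LinearMap.trace ℝ (TangentSpace 𝓘(ℝ, E) u)
        (((chartPullback I g x₁).leviCivita (mpullback 𝓘(ℝ, E) I (chartInv I x₁) Y) u :
            TangentSpace 𝓘(ℝ, E) u →ₗ[ℝ] TangentSpace 𝓘(ℝ, E) u) ∘ₗ
          ((chartPullback I g x₁).leviCivita (mpullback 𝓘(ℝ, E) I (chartInv I x₁) Y) u :
            TangentSpace 𝓘(ℝ, E) u →ₗ[ℝ] TangentSpace 𝓘(ℝ, E) u)) := by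
    rw [traceCLM_apply, ← hcov]
    rfl
  -- `tr((e⁻¹ L e) (e⁻¹ L e)) = tr(L L)`
  have hconj' : ((chartPullback I g x₁).leviCivita (mpullback 𝓘(ℝ, E) I (chartInv I x₁) Y) u :
      TangentSpace 𝓘(ℝ, E) u →ₗ[ℝ] TangentSpace 𝓘(ℝ, E) u) =
      e.symm.conj ((g.leviCivita Y (chartInv I x₁ u) : TangentSpace I (chartInv I x₁ u) →ₗ[ℝ]
          TangentSpace I (chartInv I x₁ u))) := by
    rw [hconj, LinearEquiv.conj_apply, LinearEquiv.symm_symm, LinearMap.comp_assoc]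
  rw [hR, hconj', ← LinearEquiv.conj_comp, LinearMap.trace_conj']

/-- **The representative of the Bochner field `∇_Y Y − (div Y) Y`** is the coordinate field
`covDAt Ĝ Ŷ u (Ŷ u) − divAt Ĝ Ŷ u • Ŷ u`, for `Y` smooth on the chart domain of `x₁`
(`vectorRep_leviCivita_self`, `vectorDivergence_eq_divAt_metricRep`). [folklore] -/
theorem vectorRep_bochnerField (x₁ : M) {Y : Π x : M, TangentSpace I x}
    (hY : CMDiff[(chartAt H x₁).source] ∞ (T% Y)) (u : chartTarget I x₁) :
    vectorRep I x₁ (fun y ↦ g.leviCivita Y y (Y y) - g.vectorDivergence Y y • Y y) u =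
      covDAt (metricRep I g x₁) (vectorRep I x₁ Y) u (vectorRep I x₁ Y u) -
        divAt (metricRep I g x₁) (vectorRep I x₁ Y) u • vectorRep I x₁ Y u := by
  have hx : chartInv I x₁ u ∈ (chartAt H x₁).source := chartInv_mem_source x₁ u
  have hYd : MDiffAt (T% Y) (chartInv I x₁ u) :=
    ((hY _ hx).contMDiffAt ((chartAt H x₁).open_source.mem_nhds hx)).mdifferentiableAt (by simp)
  have hYf : DifferentiableAt ℝ (vectorRep I x₁ Y) u :=
    (((contDiffOn_vectorRep x₁ hY) u u.2).contDiffAt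
      ((isOpen_extChartAt_target x₁).mem_nhds u.2)).differentiableAt (by simp)
  rw [vectorRep_apply]
  change mfderiv I 𝓘(ℝ, E) (extChartAt I x₁) (chartInv I x₁ u)
    (g.leviCivita Y (chartInv I x₁ u) (Y (chartInv I x₁ u)) -
      g.vectorDivergence Y (chartInv I x₁ u) • Y (chartInv I x₁ u)) = _
  rw [map_sub, map_smul, vectorDivergence_eq_divAt_metricRep g x₁ u hYd hYf,
    ← vectorRep_leviCivita_self g x₁ u hYd hYf]
  rfl


set_option maxSynthPendingDepth 2 in
/-- **The Bochner field `∇_Y Y − (div Y) Y` of a smooth vector field is smooth**: in the chart at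
`x` its representative is `DŶ(Ŷ) + Γ(Ŷ, Ŷ) − tr(DŶ + Γ(Ŷ, ·)) Ŷ` (`vectorRep_bochnerField`), smooth
in the smooth data `Ĝ`, `Γ`, `Ŷ`. [folklore] -/
theorem contMDiffAt_bochnerField {Y : Π x : M, TangentSpace I x} (hY : CMDiff ∞ (T% Y)) (x : M) :
    CMDiffAt ∞ (T% (fun y ↦ g.leviCivita Y y (Y y) - g.vectorDivergence Y y • Y y)) x := by
  set φ := extChartAt I x with hφ
  set c := φ x with hc
  set Ĝ := metricRep I g x with hĜ
  set Ŷ := vectorRep I x Y with hŶ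
  have hct : c ∈ φ.target := mem_extChartAt_target x
  have hT : φ.target ∈ 𝓝 c := (isOpen_extChartAt_target x).mem_nhds hct
  have hxs : x ∈ (chartAt H x).source := mem_chart_source H x
  have hĜm : IsMetricOn Ĝ φ.target :=
    Lorentzian.OpensChart.isMetricOn_repr (val_chartPullback_eq_metricRep g x)
  -- smoothness of the data at `c`
  have hŶa : ContDiffAt ℝ ∞ Ŷ c := (contDiffOn_vectorRep x hY.contMDiffOn).contDiffAt hT
  have hΓa : ContDiffAt ℝ ∞ (chrAt Ĝ) c := hĜm.contDiffAt_chrAt hct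
  have hDŶa : ContDiffAt ℝ ∞ (fderiv ℝ Ŷ) c := hŶa.fderiv_right (m := ∞) (by simp)
  -- the representative and its smoothness at `c`
  set F : E → E := fun e ↦ covDAt Ĝ Ŷ e (Ŷ e) - divAt Ĝ Ŷ e • Ŷ e with hF
  have hcov : ContDiffAt ℝ ∞ (fun e ↦ covDAt Ĝ Ŷ e) c := by
    simp only [covDAt]
    exact hDŶa.add (hΓa.clm_apply hŶa)
  have hcovY : ContDiffAt ℝ ∞ (fun e ↦ covDAt Ĝ Ŷ e (Ŷ e)) c := hcov.clm_apply hŶa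
  have hdiv : ContDiffAt ℝ ∞ (fun e ↦ divAt Ĝ Ŷ e) c := by
    simp only [divAt_eq]
    exact (traceCLM E).contDiff.contDiffAt.comp c hcov
  have hFa : ContDiffAt ℝ ∞ F c := hcovY.sub (hdiv.smul hŶa)
  -- conclude by the chart criterion (Mathlib's `Trivialization.contMDiffAt_section_iff` for the
  -- trivialization of `TM` at `x`, which reads vectors through `Dφ`; cf.
  -- `contMDiffAt_section_of_vectorRep` of `GaussBonnetGradient.lean`)
  have hYF : ∀ᶠ z in 𝓝 x, vectorRep I x (fun y ↦ g.leviCivita Y y (Y y) -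
      g.vectorDivergence Y y • Y y) (φ z) = F (φ z) := by
    filter_upwards [(chartAt H x).open_source.mem_nhds hxs] with z hz
    have hzt : φ z ∈ φ.target := φ.map_source (by rwa [hφ, _root_.extChartAt_source])
    exact vectorRep_bochnerField g x hY.contMDiffOn ⟨φ z, hzt⟩
  set e := trivializationAt E (TangentSpace I : M → Type _) x with he
  have hbase : (chartAt H x).source ⊆ e.baseSet := by simp [he]
  rw [e.contMDiffAt_section_iff (hbase hxs)]
  have h1 : ContMDiffAt I 𝓘(ℝ, E) ∞ (F ∘ φ) x := hFa.contMDiffAt.comp x (contMDiffAt_extChartAt' hxs)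
  refine h1.congr_of_eventuallyEq ?_
  filter_upwards [hYF, (chartAt H x).open_source.mem_nhds hxs] with z hz hzs
  rw [Function.comp_apply, ← hz, vectorRep_apply, (extChartAt I x).left_inv
    (by rwa [_root_.extChartAt_source]), ← TangentBundle.continuousLinearMapAt_trivializationAt hzs]
  exact (Trivialization.continuousLinearMapAt_apply_of_mem (R := ℝ) _ (hbase hzs) _).symm

omit [FiniteDimensional ℝ E] [CompleteSpace E] [g.HasLeviCivita] in
/-- **Functions read in the chart are smooth**: if `f (Φ u) = F u` on the chart target of `x` for
an `F` smooth on the target, then `f` is smooth at `x`. [folklore] -/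
theorem contMDiffAt_of_chartInv_eq (x : M) {f : M → ℝ} {F : E → ℝ}
    (hF : ContDiffOn ℝ ∞ F (extChartAt I x).target)
    (hfF : ∀ u : chartTarget I x, f (chartInv I x u) = F u) : CMDiffAt ∞ f x := by
  have hxs : x ∈ (chartAt H x).source := mem_chart_source H x
  have hT : (extChartAt I x).target ∈ 𝓝 (extChartAt I x x) :=
    (isOpen_extChartAt_target x).mem_nhds (mem_extChartAt_target x)
  have h1 : CMDiffAt ∞ (F ∘ extChartAt I x) x :=
    (hF.contDiffAt hT).contMDiffAt.comp x (contMDiffAt_extChartAt' hxs)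
  refine h1.congr_of_eventuallyEq ?_
  filter_upwards [(chartAt H x).open_source.mem_nhds hxs] with z hz
  have hzt : extChartAt I x z ∈ (extChartAt I x).target :=
    (extChartAt I x).map_source (by rwa [_root_.extChartAt_source])
  have h := hfF ⟨extChartAt I x z, hzt⟩
  rw [chartInv_extChartAt x hz] at h
  exact h

/-- **`tr(∇Y ∘ ∇Y)` is a smooth function** for a smooth vector field `Y`: in a chart it is
`tr(covDAt Ĝ Ŷ ∘ covDAt Ĝ Ŷ)` (`trace_leviCivita_comp_self_eq`). [cite: ONeill1983, Ch. 3, Prop. 3.13] -/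
theorem contMDiff_trace_leviCivita_comp_self {Y : Π x : M, TangentSpace I x} (hY : CMDiff ∞ (T% Y)) :
    CMDiff ∞ (fun y ↦ LinearMap.trace ℝ (TangentSpace I y)
      ((g.leviCivita Y y).toLinearMap ∘ₗ (g.leviCivita Y y).toLinearMap)) := by
  intro x
  have hĜm : IsMetricOn (metricRep I g x) (extChartAt I x).target :=
    Lorentzian.OpensChart.isMetricOn_repr (val_chartPullback_eq_metricRep g x)
  have hŶ : ContDiffOn ℝ ∞ (vectorRep I x Y) (extChartAt I x).target :=
    contDiffOn_vectorRep x hY.contMDiffOn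
  have hcov : ContDiffOn ℝ ∞ (fun e ↦ covDAt (metricRep I g x) (vectorRep I x Y) e)
      (extChartAt I x).target := by
    intro e he
    have hŶa : ContDiffAt ℝ ∞ (vectorRep I x Y) e := hŶ.contDiffAt (hĜm.mem_nhds he)
    have hDŶa : ContDiffAt ℝ ∞ (fderiv ℝ (vectorRep I x Y)) e := hŶa.fderiv_right (m := ∞) (by simp)
    have hΓa : ContDiffAt ℝ ∞ (chrAt (metricRep I g x)) e := hĜm.contDiffAt_chrAt he
    simp only [covDAt]
    exact (hDŶa.add (hΓa.clm_apply hŶa)).contDiffWithinAt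
  refine contMDiffAt_of_chartInv_eq x (F := fun e ↦ traceCLM E
    ((covDAt (metricRep I g x) (vectorRep I x Y) e).comp
      (covDAt (metricRep I g x) (vectorRep I x Y) e))) ?_ (fun u ↦ ?_)
  · exact (traceCLM E).contDiff.comp_contDiffOn (hcov.clm_comp hcov)
  · have hx : chartInv I x u ∈ (chartAt H x).source := chartInv_mem_source x u
    have hYd : MDiffAt (T% Y) (chartInv I x u) := (hY _).mdifferentiableAt (by simp)
    have hYf : DifferentiableAt ℝ (vectorRep I x Y) u :=
      ((hŶ u u.2).contDiffAt (hĜm.mem_nhds u.2)).differentiableAt (by simp)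
    exact trace_leviCivita_comp_self_eq g x u hYd hYf

/-- **The divergence of a smooth vector field is a smooth function**: in a chart it is
`divAt Ĝ Ŷ` (`vectorDivergence_eq_divAt_metricRep`). [cite: ONeill1983, Ch. 3, p. 86] -/
theorem contMDiff_vectorDivergence {Y : Π x : M, TangentSpace I x} (hY : CMDiff ∞ (T% Y)) :
    CMDiff ∞ (g.vectorDivergence Y) := by
  intro x
  have hĜm : IsMetricOn (metricRep I g x) (extChartAt I x).target :=
    Lorentzian.OpensChart.isMetricOn_repr (val_chartPullback_eq_metricRep g x)
  have hŶ : ContDiffOn ℝ ∞ (vectorRep I x Y) (extChartAt I x).target :=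
    contDiffOn_vectorRep x hY.contMDiffOn
  have hcov : ContDiffOn ℝ ∞ (fun e ↦ covDAt (metricRep I g x) (vectorRep I x Y) e)
      (extChartAt I x).target := by
    intro e he
    have hŶa : ContDiffAt ℝ ∞ (vectorRep I x Y) e := hŶ.contDiffAt (hĜm.mem_nhds he)
    have hDŶa : ContDiffAt ℝ ∞ (fderiv ℝ (vectorRep I x Y)) e := hŶa.fderiv_right (m := ∞) (by simp)
    have hΓa : ContDiffAt ℝ ∞ (chrAt (metricRep I g x)) e := hĜm.contDiffAt_chrAt he
    simp only [covDAt]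
    exact (hDŶa.add (hΓa.clm_apply hŶa)).contDiffWithinAt
  refine contMDiffAt_of_chartInv_eq x (F := fun e ↦ divAt (metricRep I g x) (vectorRep I x Y) e)
    ?_ (fun u ↦ ?_)
  · simp only [divAt_eq]
    exact (traceCLM E).contDiff.comp_contDiffOn hcov
  · have hYd : MDiffAt (T% Y) (chartInv I x u) := (hY _).mdifferentiableAt (by simp)
    have hYf : DifferentiableAt ℝ (vectorRep I x Y) u :=
      ((hŶ u u.2).contDiffAt (hĜm.mem_nhds u.2)).differentiableAt (by simp)
    exact vectorDivergence_eq_divAt_metricRep g x u hYd hYf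

/-- **The Bochner formula for vector fields, divergence form** (the trace of the Ricci identity;
O'Neill 1983, Ch. 3, Prop. 3.37 ff.; Gallot–Hulin–Lafontaine 2004, Prop. 4.36 for the dual
`1`-form; the pointwise identity whose integral is Yano's formula). For a smooth pseudo-Riemannian
metric `g` and a smooth vector field `Y`, at every point
`div(∇_Y Y − (div Y) Y) = Ric(Y, Y) + tr(∇Y ∘ ∇Y) − (div Y)²`.
Proof: read everything in the chart at the point (`vectorRep_bochnerField`,
`vectorDivergence_eq_divAt_metricRep`, `ricci_eq_ricAt_metricRep`, `trace_leviCivita_comp_self_eq`)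
and apply the coordinate identity `MetricCoord.IsMetricOn.divAt_bochnerField`.
[cite: ONeill1983, Ch. 3, Prop. 3.37] [cite: GallotHulinLafontaine2004, Prop. 4.36] -/
theorem vectorDivergence_bochnerField {Y : Π x : M, TangentSpace I x} (hY : CMDiff ∞ (T% Y))
    (x : M) :
    g.vectorDivergence (fun y ↦ g.leviCivita Y y (Y y) - g.vectorDivergence Y y • Y y) x =
      g.ricci x (Y x) (Y x) +
        LinearMap.trace ℝ (TangentSpace I x)
          ((g.leviCivita Y x).toLinearMap ∘ₗ (g.leviCivita Y x).toLinearMap) -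
        g.vectorDivergence Y x ^ 2 := by
  -- the chart at `x`, `u₀ = φ x`, `Φ u₀ = x`
  set u₀ : chartTarget I x := ⟨extChartAt I x x, (extChartAt I x).map_source
    (mem_extChartAt_source x)⟩ with hu₀
  have hΦu₀ : chartInv I x u₀ = x := chartInv_extChartAt x (mem_chart_source H x)
  set Ĝ := metricRep I g x with hĜdef
  set Ŷ := vectorRep I x Y with hŶdef
  have hĜ : IsMetricOn Ĝ (chartTarget I x : Set E) :=
    isMetricOn_repr (val_chartPullback_eq_metricRep g x)
  have hYon : CMDiff[(chartAt H x).source] ∞ (T% Y) := hY.contMDiffOn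
  have hŶs : ContDiffOn ℝ ∞ Ŷ (chartTarget I x : Set E) := contDiffOn_vectorRep x hYon
  -- the representative of the Bochner field and its differentiability
  set Xf : E → E := fun e ↦ covDAt Ĝ Ŷ e (Ŷ e) - divAt Ĝ Ŷ e • Ŷ e with hXf
  have hrep : ∀ u : chartTarget I x,
      vectorRep I x (fun y ↦ g.leviCivita Y y (Y y) - g.vectorDivergence Y y • Y y) u = Xf u :=
    fun u ↦ vectorRep_bochnerField g x hYon u
  have hZd : DifferentiableAt ℝ Ŷ u₀ :=
    ((hŶs u₀ u₀.2).contDiffAt (hĜ.mem_nhds u₀.2)).differentiableAt (by simp)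
  have hXfd : DifferentiableAt ℝ Xf u₀ :=
    (hĜ.hasFDerivAt_covDAt_self u₀.2 hŶs).differentiableAt.sub
      ((hĜ.hasFDerivAt_divAt u₀.2 hŶs).differentiableAt.smul hZd)
  -- the Bochner field is a differentiable section at `x`
  have hXd : MDiffAt (T% (fun y ↦ g.leviCivita Y y (Y y) - g.vectorDivergence Y y • Y y)) x :=
    (contMDiffAt_bochnerField g hY x).mdifferentiableAt (by simp)
  -- read the divergence, the Ricci term and the trace in the chart
  have heq : vectorRep I x (fun y ↦ g.leviCivita Y y (Y y) - g.vectorDivergence Y y • Y y)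
      =ᶠ[𝓝 (u₀ : E)] Xf := by
    filter_upwards [(isOpen_extChartAt_target x).mem_nhds u₀.2] with e he
    exact hrep ⟨e, he⟩
  have hXrepd : DifferentiableAt ℝ
      (vectorRep I x (fun y ↦ g.leviCivita Y y (Y y) - g.vectorDivergence Y y • Y y)) u₀ :=
    hXfd.congr_of_eventuallyEq heq
  have hXd' : MDiffAt (T% (fun y ↦ g.leviCivita Y y (Y y) - g.vectorDivergence Y y • Y y))
      (chartInv I x u₀) := by
    rw [hΦu₀]; exact hXd
  have hdiv : g.vectorDivergence (fun y ↦ g.leviCivita Y y (Y y) - g.vectorDivergence Y y • Y y) x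
      = divAt Ĝ Xf u₀ := by
    have h1 := vectorDivergence_eq_divAt_metricRep g x u₀ hXd' hXrepd
    rw [hΦu₀] at h1
    rw [h1, divAt_congr_of_eventuallyEq heq]
  have hYd₀ : MDiffAt (T% Y) (chartInv I x u₀) := (hY _).mdifferentiableAt (by simp)
  have hric : g.ricci x (Y x) (Y x) = ricAt Ĝ u₀ (Ŷ u₀) (Ŷ u₀) := by
    rw [← ricci_eq_ricAt_metricRep g x Y Y u₀, hΦu₀]
  have htr : LinearMap.trace ℝ (TangentSpace I x)
      ((g.leviCivita Y x).toLinearMap ∘ₗ (g.leviCivita Y x).toLinearMap) =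
      traceCLM E ((covDAt Ĝ Ŷ u₀).comp (covDAt Ĝ Ŷ u₀)) := by
    have h := trace_leviCivita_comp_self_eq g x u₀ hYd₀ hZd
    rw [hΦu₀] at h
    exact h
  have hdivY : g.vectorDivergence Y x = divAt Ĝ Ŷ u₀ := by
    have h := vectorDivergence_eq_divAt_metricRep g x u₀ hYd₀ hZd
    rw [hΦu₀] at h
    exact h
  rw [hdiv, hric, htr, hdivY, hXf]
  exact hĜ.divAt_bochnerField u₀.2 hŶs

end Chart

/-! ### Yano's integral formula on a closed Riemannian manifold -/

section Integral

variable {m : ℕ} {H : Type*} [TopologicalSpace H]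
  {I : ModelWithCorners ℝ (EuclideanSpace ℝ (Fin m)) H} [I.Boundaryless]
  {N : Type*} [TopologicalSpace N] [ChartedSpace H N] [IsManifold I ∞ N] [CompactSpace N]
  [T2Space N] [MeasurableSpace N] [BorelSpace N]
  (h : ContMDiffRiemannianMetric I ∞ (EuclideanSpace ℝ (Fin m)) (TangentSpace I : N → Type _))
  [(ofRiemannian h).HasLeviCivita]

/-- **Yano's integral formula** (K. Yano 1952, (1.8); Gallot–Hulin–Lafontaine 2004, proof of
Thm. 4.37, `⟨Δα, α⟩ = ⟨Dα, Dα⟩ + ∫ Ric(α, α)`): on a closed Riemannian manifold `(N, h)` modelled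
on `ℝᵐ`, for every smooth vector field `Y`,
`∫_N (Ric(Y, Y) + tr(∇Y ∘ ∇Y) − (div Y)²) dμ_h = 0` — the divergence theorem
(`integral_vectorDivergence_eq_zero`) applied to the smooth field `∇_Y Y − (div Y) Y`
(`contMDiffAt_bochnerField`), whose divergence is the integrand (`vectorDivergence_bochnerField`).
[cite: GallotHulinLafontaine2004, Thm. 4.37 (proof)] [cite: ONeill1983, Ch. 3, Prop. 3.37] -/
theorem integral_ricci_add_trace_sub_divergence_sq_eq_zero {Y : Π x : N, TangentSpace I x}
    (hY : CMDiff ∞ (T% Y)) :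
    ∫ p, ((ofRiemannian h).ricci p (Y p) (Y p) +
        LinearMap.trace ℝ (TangentSpace I p)
          (((ofRiemannian h).leviCivita Y p).toLinearMap ∘ₗ
            ((ofRiemannian h).leviCivita Y p).toLinearMap) -
        (ofRiemannian h).vectorDivergence Y p ^ 2) ∂riemannianMeasure h = 0 := by
  have hW : CMDiff 1 (T% (fun y ↦ (ofRiemannian h).leviCivita Y y (Y y) -
      (ofRiemannian h).vectorDivergence Y y • Y y)) := fun x ↦
    (contMDiffAt_bochnerField (ofRiemannian h) hY x).of_le (by exact_mod_cast le_top)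
  obtain ⟨-, h0⟩ := integral_vectorDivergence_eq_zero h hW
  have heq : (ofRiemannian h).vectorDivergence (fun y ↦ (ofRiemannian h).leviCivita Y y (Y y) -
      (ofRiemannian h).vectorDivergence Y y • Y y) = fun p ↦ (ofRiemannian h).ricci p (Y p) (Y p) +
        LinearMap.trace ℝ (TangentSpace I p)
          (((ofRiemannian h).leviCivita Y p).toLinearMap ∘ₗ
            ((ofRiemannian h).leviCivita Y p).toLinearMap) -
        (ofRiemannian h).vectorDivergence Y p ^ 2 :=
    funext fun p ↦ vectorDivergence_bochnerField (ofRiemannian h) hY p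
  rw [heq] at h0
  exact h0

/-- **Yano's integral formula, split form**: on a closed Riemannian manifold, for a smooth vector
field `Y`, `∫ Ric(Y, Y) dμ_h + ∫ tr(∇Y ∘ ∇Y) dμ_h = ∫ (div Y)² dμ_h` (all three integrands are
continuous: `contMDiff_ricci_apply'`, `contMDiff_trace_leviCivita_comp_self`,
`contMDiff_vectorDivergence`). With `|∇Y|² = |A_sym|² + |A_anti|²` and
`tr(∇Y ∘ ∇Y) = |A_sym|² − |A_anti|²` for `A = ∇Y` this is
`∫|∇α|² + ∫Ric(α, α) = ½∫|dα|² + ∫(δα)²` for the `1`-form `α = Y♭`, Gallot–Hulin–Lafontaine's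
`⟨Δα, α⟩ = ⟨Dα, Dα⟩ + ∫ Ric(α, α)`, from which Bochner's theorem (Thm. 4.37) and Aubry's Lemme 9
(`λ₁¹ ≥ n` under `Ric ≥ n − 1`) follow. [cite: GallotHulinLafontaine2004, Thm. 4.37 (proof)]
[cite: Aubry2005, Lemme 9 (p. 392)] -/
theorem integral_ricci_add_integral_trace_eq_integral_divergence_sq {Y : Π x : N, TangentSpace I x}
    (hY : CMDiff ∞ (T% Y)) :
    ∫ p, (ofRiemannian h).ricci p (Y p) (Y p) ∂riemannianMeasure h +
      ∫ p, LinearMap.trace ℝ (TangentSpace I p)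
          (((ofRiemannian h).leviCivita Y p).toLinearMap ∘ₗ
            ((ofRiemannian h).leviCivita Y p).toLinearMap) ∂riemannianMeasure h =
      ∫ p, (ofRiemannian h).vectorDivergence Y p ^ 2 ∂riemannianMeasure h := by
  have h0 := integral_ricci_add_trace_sub_divergence_sq_eq_zero h hY
  have hc1 : Continuous fun p ↦ (ofRiemannian h).ricci p (Y p) (Y p) :=
    (contMDiff_ricci_apply' (ofRiemannian h) hY hY).continuous
  have hc2 : Continuous fun p ↦ LinearMap.trace ℝ (TangentSpace I p)
      (((ofRiemannian h).leviCivita Y p).toLinearMap ∘ₗ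
        ((ofRiemannian h).leviCivita Y p).toLinearMap) :=
    (contMDiff_trace_leviCivita_comp_self (ofRiemannian h) hY).continuous
  have hc3 : Continuous fun p ↦ (ofRiemannian h).vectorDivergence Y p ^ 2 :=
    (contMDiff_vectorDivergence (ofRiemannian h) hY).continuous.pow 2
  have i1 := integrable_of_continuous h hc1
  have i2 := integrable_of_continuous h hc2
  have i3 := integrable_of_continuous h hc3
  have i12 : Integrable (fun p ↦ (ofRiemannian h).ricci p (Y p) (Y p) +
      LinearMap.trace ℝ (TangentSpace I p)
        (((ofRiemannian h).leviCivita Y p).toLinearMap ∘ₗ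
          ((ofRiemannian h).leviCivita Y p).toLinearMap)) (riemannianMeasure h) := i1.add i2
  rw [integral_sub i12 i3, integral_add i1 i2] at h0
  linarith

end Integral

end Literature.Geometry.Riemannian

end
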